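import Summits.ResolutionOfSingularities.ResolutionOfSingularities.Theorems.MarkedTransferCampaignW46MohWindowShadeFormalNRChart
import HarnessLib

/-!
# [OURS · L1 W4.6 rung (iii-2), NON-RATIONAL POINTS, brick 5] Change of chart at a non-rational point of the torus of the exceptional line:
# the coordinate `v ↦ v⁻¹`, the minimal polynomial `π ↦` its normalised reverse

Cell `res-hironaka`, LADDER-RESOLUTION rung L (D-0089), slot W4.6 rung (iii); seat res-L1-s46-pv-6 (gen 7). Host route MarkedTransfer,
`--supports stmt-ResolutionOfSingularities-16155 --as helper`; kind proof (no definition). NON-RATIONAL twin of res-L1-s46-pv-2's brick 10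
(`FormalChart.exists_chartData_reindex`, `WildConesCampaignW46ChartReindex.lean`). The Hauser–Wagner frame of this seat's shade model reads
translated points in the chart `u₀` only; the Rees-chart presentation of a stalk (`IsBlowup.exists_reesChart_stalk`) may deliver the chart `u₁`
for a point of the torus `{u₀ u₁ ≠ 0}` of the exceptional line. At such a point the non-rational chart data
`𝔪_L = (a, e_z, π̃^g(v))` (`v = u₀/u₁` a unit, `π̃ ∈ R[X]` monic with irreducible reduction `π`, `π(0) ≠ 0`) are rewritten in the chart `u₀`:
`𝔪_L = (a v, e_z v⁻¹, ρ̃^g(v⁻¹))` with `ρ̃ = π̃(0)⁻¹ · π̃^{rev}` monic with irreducible reduction (the minimal polynomial of `v̄⁻¹`), and every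
element of `L` is an `R`-polynomial in `v⁻¹` modulo `𝔪_L` (`v ≡ −π̃(0) · ρ̃^{divX}(v⁻¹)`). Pure algebra; NOTHING here is a statement of
H. Hironaka's manuscript [Hironaka2017] and nothing of it is used; no FACT-LIST premise. AI-written; AI review is weaker than expert review.
References: The Stacks Project, Tag 0804; Mathlib `Polynomial.reverse`, `eval₂_reverse_mul_pow`. [StacksProject] [folklore]
-/

noncomputable section

set_option linter.dupNamespace false -- mandated namespace of this single-conjunct summit

open IsLocalRing Polynomial

namespace Summit.ResolutionOfSingularities.ResolutionOfSingularities.Theorems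

namespace CampaignW46

namespace MohWindowShadeFormalNR

universe u

/-! ## §1 Reverse of a polynomial with non-zero constant term -/

section Reverse

variable {A : Type u} [CommRing A]

/-- `reverse` is an involution on polynomials with non-zero constant term. [folklore] -/
theorem reverse_reverse_of_coeff_zero_ne (f : A[X]) (h : f.coeff 0 ≠ 0) : f.reverse.reverse = f := by
  have htr : f.natTrailingDegree = 0 := natTrailingDegree_eq_zero.mpr (Or.inr h)
  have hdeg : f.reverse.natDegree = f.natDegree := by
    have := natDegree_eq_reverse_natDegree_add_natTrailingDegree f
    rw [htr, add_zero] at this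
    exact this.symm
  ext n
  rw [coeff_reverse, hdeg, coeff_reverse, revAt_invol]

/-- A polynomial with non-zero constant term whose reverse is a unit is a unit. [folklore] -/
theorem isUnit_of_isUnit_reverse {κ : Type u} [Field κ] (a : κ[X]) (ha0 : a.coeff 0 ≠ 0) (h : IsUnit a.reverse) : IsUnit a := by
  have h1 : a.reverse.natDegree = 0 := natDegree_eq_zero_of_isUnit h
  have h2 : a.natDegree = 0 := by
    have := natDegree_eq_reverse_natDegree_add_natTrailingDegree a
    rw [h1, natTrailingDegree_eq_zero.mpr (Or.inr ha0), add_zero] at this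
    exact this
  rw [eq_C_of_natDegree_eq_zero h2]
  exact isUnit_C.mpr (isUnit_iff_ne_zero.mpr ha0)

/-- Over a field, the reverse of an irreducible polynomial with non-zero constant term is irreducible. [folklore] -/
theorem irreducible_reverse {κ : Type u} [Field κ] {π : κ[X]} (hirr : Irreducible π) (h0 : π.coeff 0 ≠ 0) : Irreducible π.reverse := by
  have hrr : π.reverse.reverse = π := reverse_reverse_of_coeff_zero_ne π h0
  have hlc : π.reverse.coeff 0 ≠ 0 := by rw [coeff_zero_reverse]; exact leadingCoeff_ne_zero.mpr hirr.ne_zero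
  refine ⟨fun hu => ?_, fun a b hab => ?_⟩
  · exact hirr.not_isUnit (isUnit_of_isUnit_reverse π h0 hu)
  · have hab0 : a.coeff 0 * b.coeff 0 ≠ 0 := by rw [← mul_coeff_zero, ← hab]; exact hlc
    have ha0 : a.coeff 0 ≠ 0 := left_ne_zero_of_mul hab0
    have hb0 : b.coeff 0 ≠ 0 := right_ne_zero_of_mul hab0
    have hπ : π = a.reverse * b.reverse := by rw [← hrr, hab, reverse_mul_of_domain]
    rcases hirr.isUnit_or_isUnit hπ with ha | hb
    · exact Or.inl (isUnit_of_isUnit_reverse a ha0 ha)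
    · exact Or.inr (isUnit_of_isUnit_reverse b hb0 hb)

/-- The reverse, read coefficientwise through a ring map under which the degree does not drop. [folklore] -/
theorem map_reverse_of_natDegree_eq {B : Type u} [CommRing B] (φ : A →+* B) (f : A[X]) (h : (f.map φ).natDegree = f.natDegree) :
    f.reverse.map φ = (f.map φ).reverse := by
  change (f.reflect f.natDegree).map φ = (f.map φ).reflect (f.map φ).natDegree
  rw [h, reflect_map]

end Reverse

/-! ## §2 The change of chart `v ↦ v⁻¹` for non-rational chart data -/

section Reindex

variable {R L : Type} [CommRing R] [IsLocalRing R] [CommRing L] [IsLocalRing L] (g : R →+* L)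
  (hg : (maximalIdeal R).map g ≤ maximalIdeal L)

include hg in
/-- The constant coefficient of `π̃` is a unit when `π̃^g(v) ∈ 𝔪_L` for a unit `v` and the reduction of the monic `π̃` is irreducible
(otherwise the reduction is `X` and `v ≡ 0`). [folklore] -/
theorem isUnit_coeff_zero_of_eval_unit_mem (πR : R[X]) (hm : πR.Monic) (hirr : Irreducible (πR.map (residue R))) {v : L} (hv : IsUnit v)
    (hπv : (πR.map g).eval v ∈ maximalIdeal L) : IsUnit (πR.coeff 0) := by
  by_contra hπ₀
  have hmem : πR.coeff 0 ∈ maximalIdeal R := (IsLocalRing.mem_maximalIdeal _).mpr hπ₀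
  set π := πR.map (residue R) with hπ
  have hπm : π.Monic := hm.map _
  have hX : (X : (ResidueField R)[X]) ∣ π := by
    rw [X_dvd_iff, hπ, coeff_map]
    exact (IsLocalRing.residue_eq_zero_iff _).mpr hmem
  obtain ⟨q, hq⟩ := hX
  have hqunit : IsUnit q := by
    rcases hirr.isUnit_or_isUnit hq with h | h
    · exact absurd h Polynomial.not_isUnit_X
    · exact h
  have hdegπ : π.natDegree = 1 := by
    rw [hq, natDegree_mul X_ne_zero hqunit.ne_zero, natDegree_X, natDegree_eq_zero_of_isUnit hqunit]
  have hdeg : πR.natDegree = 1 := by rw [← hm.natDegree_map (residue R)]; exact hdegπ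
  have hform := hm.eq_X_add_C hdeg
  have hval : (πR.map g).eval v = v + g (πR.coeff 0) := by
    conv_lhs => rw [hform]
    rw [Polynomial.map_add, Polynomial.map_X, Polynomial.map_C, eval_add, eval_X, eval_C]
  have hv𝔪 : v ∈ maximalIdeal L := by
    have h1 : g (πR.coeff 0) ∈ maximalIdeal L := hg (Ideal.mem_map_of_mem _ hmem)
    have h2 := Ideal.sub_mem _ hπv h1
    rwa [hval, add_sub_cancel_right] at h2
  exact (IsLocalRing.mem_maximalIdeal _).mp hv𝔪 hv

include hg in
/-- [OURS · L1 W4.6 — DICTIONARY AT A NON-RATIONAL POINT, brick 5; replaces the role of «the closed point `ξ′ ∈ π⁻¹(ξ)` of the blowup»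
(H. Hironaka, ms. 2017, Th. 16.6 p.84 l.10) READ IN THE OTHER CHART; NOT a statement of the manuscript] **Change of chart at a non-rational
point of the torus of the exceptional line.** Non-rational chart data `𝔪_L = (a, e_z, π̃^g(v))`, every element of `L` an `R`-polynomial in `v`
modulo `𝔪_L`, with `v` a UNIT (`v v′ = 1`): then `𝔪_L = (a v, e_z v′, ρ̃^g(v′))` with `ρ̃ = π̃(0)⁻¹ π̃^{rev}` monic with irreducible reduction,
and every element of `L` is an `R`-polynomial in `v′` modulo `𝔪_L`. [cite: StacksProject, Tag 0804] [folklore] -/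
theorem exists_reindex_nr (a ez v v' : L) (hvv' : v * v' = 1) (πR : R[X]) (hm : πR.Monic) (hirr : Irreducible (πR.map (residue R)))
    (hgen : Ideal.span {a, ez, (πR.map g).eval v} = maximalIdeal L)
    (hres : ∀ y : L, ∃ P : R[X], y - (P.map g).eval v ∈ maximalIdeal L) :
    ∃ ρR : R[X], ρR.Monic ∧ Irreducible (ρR.map (residue R)) ∧
      Ideal.span {a * v, ez * v', (ρR.map g).eval v'} = maximalIdeal L ∧
      ∀ y : L, ∃ Q : R[X], y - (Q.map g).eval v' ∈ maximalIdeal L := by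
  classical
  have hv : IsUnit v := IsUnit.of_mul_eq_one v' hvv'
  have hv' : IsUnit v' := IsUnit.of_mul_eq_one v (by rw [mul_comm]; exact hvv')
  letI : Invertible v := ⟨v', by rw [mul_comm]; exact hvv', hvv'⟩
  have hinv : (⅟ v : L) = v' := rfl
  have hπv : (πR.map g).eval v ∈ maximalIdeal L := by rw [← hgen]; exact Ideal.subset_span (by simp)
  have hπ₀ : IsUnit (πR.coeff 0) := isUnit_coeff_zero_of_eval_unit_mem g hg πR hm hirr hv hπv
  haveI : Nontrivial R := inferInstance
  have hπ₀ne : πR.coeff 0 ≠ 0 := hπ₀.ne_zero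
  set u₀ := hπ₀.unit with hu₀
  have hu₀val : (u₀ : R) = πR.coeff 0 := hπ₀.unit_spec
  -- the normalised reverse
  set ρR : R[X] := C (↑u₀⁻¹ : R) * πR.reverse with hρR
  have htr : πR.natTrailingDegree = 0 := natTrailingDegree_eq_zero.mpr (Or.inr hπ₀ne)
  have hlead : πR.reverse.leadingCoeff = πR.coeff 0 := by
    rw [reverse_leadingCoeff, trailingCoeff, htr]
  have hρm : ρR.Monic := by
    refine monic_C_mul_of_mul_leadingCoeff_eq_one ?_
    rw [hlead, ← hu₀val, Units.inv_mul]
  -- its reduction is the normalised reverse of the (irreducible) reduction of `π̃`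
  have hdegmap : (πR.map (residue R)).natDegree = πR.natDegree := hm.natDegree_map _
  have hρirr : Irreducible (ρR.map (residue R)) := by
    rw [hρR, Polynomial.map_mul, Polynomial.map_C, map_reverse_of_natDegree_eq (residue R) πR hdegmap]
    refine (irreducible_isUnit_mul (isUnit_C.mpr ((Units.isUnit u₀⁻¹).map (residue R)))).mpr (irreducible_reverse hirr ?_)
    rw [coeff_map]
    exact (IsLocalRing.residue_ne_zero_iff_isUnit _).mpr hπ₀
  -- the evaluation relation `ρ̃^g(v′) · g(π̃(0)) · v^d = π̃^g(v)`
  have hev : (ρR.map g).eval v' * (g (πR.coeff 0) * v ^ πR.natDegree) = (πR.map g).eval v := by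
    have h1 := eval₂_reverse_mul_pow g v πR
    rw [hinv] at h1
    have h1' : (πR.map g).eval v = eval₂ g v' πR.reverse * v ^ πR.natDegree := by rw [eval_map, h1]
    have h3 : (ρR.map g).eval v' = g (↑u₀⁻¹ : R) * eval₂ g v' πR.reverse := by
      rw [hρR, Polynomial.map_mul, Polynomial.map_C, eval_mul, eval_C, eval_map]
    have h2 : g (↑u₀⁻¹ : R) * g (πR.coeff 0) = 1 := by rw [← map_mul, ← hu₀val, Units.inv_mul, map_one]
    rw [h1', h3]
    linear_combination (eval₂ g v' πR.reverse * v ^ πR.natDegree) * h2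
  have hunit : IsUnit (g (πR.coeff 0) * v ^ πR.natDegree) := (hπ₀.map g).mul (hv.pow _)
  refine ⟨ρR, hρm, hρirr, ?_, fun y => ?_⟩
  · -- the spans agree generator by generator up to units
    rw [← hgen, Ideal.span_insert, Ideal.span_insert, Ideal.span_insert, Ideal.span_insert, Ideal.span_singleton_mul_right_unit hv,
      Ideal.span_singleton_mul_right_unit hv', ← Ideal.span_singleton_mul_right_unit hunit ((ρR.map g).eval v'), hev]
  · -- `v ≡ −π̃(0) · ρ̃^{divX}(v′)`, so polynomials in `v` are polynomials in `v′`
    obtain ⟨P, hP⟩ := hres y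
    set V : R[X] := -(C (πR.coeff 0) * ρR.divX) with hV
    have hρv' : (ρR.map g).eval v' ∈ maximalIdeal L := by
      have : (πR.map g).eval v ∈ maximalIdeal L := hπv
      rw [← hev] at this
      exact ((Ideal.unit_mul_mem_iff_mem _ hunit).mp (by rw [mul_comm]; exact this))
    have hρ0 : ρR.coeff 0 = ↑u₀⁻¹ := by
      rw [hρR, coeff_C_mul, coeff_zero_reverse, hm.leadingCoeff, mul_one]
    have hvV : v - (V.map g).eval v' ∈ maximalIdeal L := by
      -- `ρ̃ = X · divX ρ̃ + C ρ̃(0)` evaluated at `v′`, times `v · g(π̃(0))`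
      have hsplit : (ρR.map g).eval v' = v' * ((divX ρR).map g).eval v' + g (↑u₀⁻¹ : R) := by
        conv_lhs => rw [← X_mul_divX_add ρR]
        rw [Polynomial.map_add, Polynomial.map_mul, Polynomial.map_X, Polynomial.map_C, eval_add, eval_mul, eval_X, eval_C, hρ0]
      have h2 : g (πR.coeff 0) * g (↑u₀⁻¹ : R) = 1 := by rw [← map_mul, ← hu₀val, Units.mul_inv, map_one]
      have e1 : v - (V.map g).eval v' = v * g (πR.coeff 0) * (ρR.map g).eval v' := by
        rw [hV, Polynomial.map_neg, Polynomial.map_mul, Polynomial.map_C, eval_neg, eval_mul, eval_C]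
        linear_combination (-(v * g (πR.coeff 0))) * hsplit - v * h2 - (g (πR.coeff 0) * ((divX ρR).map g).eval v') * hvv'
      rw [e1]
      exact Ideal.mul_mem_left _ _ hρv'
    refine ⟨P.comp V, ?_⟩
    have e2 : ((P.comp V).map g).eval v' = (P.map g).eval ((V.map g).eval v') := by rw [Polynomial.map_comp, eval_comp]
    rw [e2]
    have e3 : y - (P.map g).eval ((V.map g).eval v') = (y - (P.map g).eval v) + ((P.map g).eval v - (P.map g).eval ((V.map g).eval v')) := by ring
    rw [e3]
    exact Ideal.add_mem _ hP (eval_sub_eval_mem _ hvV)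

end Reindex

end MohWindowShadeFormalNR

end CampaignW46

end Summit.ResolutionOfSingularities.ResolutionOfSingularities.Theorems

end
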